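import Mathlib
import Summits.Ventures.PercRepro2.Defs
import Summits.Ventures.PercRepro2.Independence
import Summits.Ventures.PercRepro2.Harris
import Summits.Ventures.PercRepro2.Graph
import Summits.Ventures.PercRepro2.Exploration
import Summits.Ventures.PercRepro2.Events
import Summits.Ventures.PercRepro2.FourFunctions
import Summits.Ventures.PercRepro2.Induced
import Summits.Ventures.PercRepro2.Frontier
import Summits.Ventures.PercRepro2.ObsIndependence
import Summits.Ventures.PercRepro2.BHK
import Summits.Ventures.PercRepro2.BHKEvents
import Summits.Ventures.PercRepro2.MultiSource
import Summits.Ventures.PercRepro2.OrderPreservation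
import Summits.Ventures.PercRepro2.SeedSet
import Summits.Ventures.PercRepro2.MultiSourceFun
import Summits.Ventures.PercRepro2.CrossRootT
import Summits.Ventures.PercRepro2.VdBKahn
import Summits.Ventures.PercRepro2.HullDefs
import Summits.Ventures.PercRepro2.CCTRootEdge
import Summits.Ventures.PercRepro2.PASubDefs

/-!
# Theorem HALF-N: the "`e` opened only inside `G − K`" half of the T-frame (blind cell PercRepro2,
typer-1; mine-c g3 `proofs/MINEC-THEOREMS.md` Theorem HALF-N, INBOX 2026-08-23T11:03:51Z)

With `K⁻ = C_{ω⁻}(T)` the `e`-CLOSED seed cluster, `λ₀` its law on `{s ∉ K⁻}` (the `e`-deleted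
avoidance measure), `x₀(W) = P(s ↔ a in (G − e) with the edges at W deleted)` (`Xdel`),
`x₁(W) = P(s ↔ a in G/e with the edges at W deleted)` (`XdelP`) and `x̃(W) = x₁(W)` if `e = {u, w}`
does not touch `W`, `x₀(W)` otherwise (`xt`):

**`halfN`** (cleared by `λ₀`'s total mass `S`): `0 ≤ S · Σ x̃ ỹ λ − (Σ x₀ λ)(Σ ỹ λ) − (Σ y₀ λ)(Σ x̃ λ)
+ (Σ x₀ λ)(Σ y₀ λ)`, i.e. `E_{λ₀}[(x̃ − m⁰_X)(ỹ − m⁰_Y)] ≥ 0` with `m⁰_X = E_{λ₀}[x₀]`: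
`x̃` is antitone in `W` (`xt_anti`), so `Cov_{λ₀}(x̃, ỹ) ≥ 0` by `bhk_multi` for the seed set `T`
avoiding `{s}` under `p[e ↦ 0]` (`expect_update_zero_K`), and `x̃ ≥ x₀` pointwise gives two
nonnegative shifts.
-/

namespace Summit.Ventures.PercRepro2

namespace HalfN

open PASub

open scoped Classical

variable {V : Type*} {E : Type*} [Fintype E] [DecidableEq E] [Fintype V] [DecidableEq V]
  {R : Type*} [Field R] [LinearOrder R] [IsStrictOrderedRing R]

section Objects

variable (ends : E → Sym2 V) (e : E) (s : V) (T : Finset V)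

/-- The `e`-closed cluster of the seed set `T`. -/
def KsetM (ω : Config E) : Set V := clusterSet ends (Function.update ω e false) T

/-- The event `{K⁻ = W}`. -/
def KEventM (W : Set V) : Set (Config E) := {ω | KsetM ends e T ω = W}

/-- The `e`-open connection with the edges at `W` deleted. -/
def XdelP (W : Set V) (a : V) : Set (Config E) :=
  {ω | Conn ends (delConfig ends W (Function.update ω e true)) s a}

omit [Fintype E] [DecidableEq V] [Fintype V] in
/-- `{K⁻ = W}` depends only on the edges touching `W`. -/
lemma dependsOn_KEventM (W : Set V) : DependsOn (· ∈ KEventM ends e T W) (touches ends W) := by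
  intro ω ω' h
  have h' : ∀ e' ∈ touches ends W,
      Function.update ω e false e' = Function.update ω' e false e' := by
    intro e' he'
    by_cases hee : e' = e
    · subst hee; simp
    · rw [Function.update_of_ne hee, Function.update_of_ne hee]; exact h e' he'
  exact propext ⟨fun hK => _root_.Summit.Ventures.PercRepro2.clusterSet_eq_of_eqOn_touches h' hK,
    fun hK => _root_.Summit.Ventures.PercRepro2.clusterSet_eq_of_eqOn_touches
      (fun e' he' => (h' e' he').symm) hK⟩

omit [Fintype E] [DecidableEq V] [Fintype V] in
/-- `x₀ ≤ x₁` pointwise (opening `e` can only help). -/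
lemma Xdel_subset_XdelP (W : Set V) (a : V) : Xdel ends e s W a ⊆ XdelP ends e s W a := by
  intro ω hω
  refine conn_mono (fun e' => ?_) hω
  by_cases h : e' ∈ touches ends W
  · rw [delConfig_apply_of_mem h]; exact Bool.false_le _
  · rw [delConfig_apply_of_notMem h, delConfig_apply_of_notMem h]
    exact CCT.update_false_le_update_true' ω e e'

omit [Fintype E] [DecidableEq V] [Fintype V] in
/-- `x₁` is antitone in `W`. -/
lemma XdelP_anti {W W' : Set V} (h : W ⊆ W') (a : V) :
    XdelP ends e s W' a ⊆ XdelP ends e s W a :=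
  fun _ hω => conn_mono (delConfig_anti h _) hω

omit [Fintype E] [DecidableEq V] [Fintype V] in
/-- If `e` touches `W`, the `e`-open and `e`-closed `W`-deleted connections agree. -/
lemma XdelP_eq_Xdel_of_touch {W : Set V} (he : e ∈ touches ends W) (a : V) :
    XdelP ends e s W a = Xdel ends e s W a := by
  ext ω
  simp only [XdelP, Xdel, Set.mem_setOf_eq]
  have : delConfig ends W (Function.update ω e true) = delConfig ends W (Function.update ω e false) := by
    refine delConfig_congr fun e' he' => ?_
    have hne : e' ≠ e := fun h => he' (h ▸ he)
    rw [Function.update_of_ne hne, Function.update_of_ne hne]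
  rw [this]

end Objects

section Law

variable (p : E → R) (ends : E → Sym2 V) (e : E) (s : V) (T : Finset V)

omit [Fintype E] [DecidableEq V] [Fintype V] in
/-- `ω⁻` avoids `{s}` as a seed set iff `s ∉ K⁻`. -/
lemma update_false_mem_avoidAllT_iff (ω : Config E) :
    Function.update ω e false ∈ avoidAllT ends T {s} ↔ s ∉ KsetM ends e T ω := by
  simp only [avoidAllT, Set.mem_setOf_eq, Finset.mem_singleton, forall_eq, KsetM, mem_clusterSet,
    not_exists, not_and]

omit [DecidableEq V] [LinearOrder R] [IsStrictOrderedRing R] in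
/-- Transfer of the `e`-closed seed-set law: `E_{p[e↦0]}[f(C(T)) · 1_{T ↮ s}] = Σ_W [s ∉ W] f(W) P(K⁻ = W)`. -/
lemma expect_update_zero_K (f : Set V → R) :
    expect (Function.update p e 0)
        (fun ω => f (clusterSet ends ω T) * (avoidAllT ends T {s}).indicator 1 ω) =
      ∑ W : Set V, if s ∉ W then f W * prob p (KEventM ends e T W) else 0 := by
  rw [expect_update_zero]
  unfold expect prob
  have hmove : ∀ W : Set V,
      (if s ∉ W then f W * ∑ ω, (KEventM ends e T W).indicator (weight p) ω else 0) =
        ∑ ω, if s ∉ W then f W * (KEventM ends e T W).indicator (weight p) ω else 0 := by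
    intro W
    split_ifs <;> simp [Finset.mul_sum]
  simp_rw [hmove]
  rw [Finset.sum_comm]
  refine Finset.sum_congr rfl fun ω _ => ?_
  rw [Finset.sum_eq_single (KsetM ends e T ω)]
  · by_cases hs : s ∉ KsetM ends e T ω
    · have h1 : ω ∈ KEventM ends e T (KsetM ends e T ω) := rfl
      rw [if_pos hs, Set.indicator_of_mem h1,
        Set.indicator_of_mem ((update_false_mem_avoidAllT_iff ends e s T ω).2 hs)]
      simp only [KsetM, Pi.one_apply, mul_one]
      ring
    · rw [if_neg hs, Set.indicator_of_notMem
        (fun h => hs ((update_false_mem_avoidAllT_iff ends e s T ω).1 h))]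
      simp
  · intro W _ hW
    by_cases hs : s ∉ W
    · have h2 : ω ∉ KEventM ends e T W := fun h => hW h.symm
      rw [if_pos hs, Set.indicator_of_notMem h2]
      simp
    · rw [if_neg hs]
  · intro h
    exact absurd (Finset.mem_univ _) h

end Law

section Main

variable (p : E → R) (ends : E → Sym2 V) (e : E) (s : V) (T : Finset V)

/-- `x̃(W) = x₁(W)` if `e` does not touch `W`, `x₀(W)` otherwise. -/
noncomputable def xt (a : V) (W : Set V) : R :=
  if e ∈ touches ends W then prob p (Xdel ends e s W a) else prob p (XdelP ends e s W a)

/-- `x₀ ≤ x̃` pointwise. -/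
lemma Xdel_le_xt (hp : IsProbVec p) (a : V) (W : Set V) :
    prob p (Xdel ends e s W a) ≤ xt p ends e s a W := by
  unfold xt
  split_ifs
  · exact le_refl _
  · exact prob_mono hp (Xdel_subset_XdelP ends e s W a)

/-- `x̃ ≤ 1`. -/
lemma xt_le_one (hp : IsProbVec p) (a : V) (W : Set V) : xt p ends e s a W ≤ 1 := by
  unfold xt
  split_ifs <;> exact prob_le_one hp _

/-- `x̃` is antitone in `W`. -/
lemma xt_anti (hp : IsProbVec p) (a : V) {W W' : Set V} (h : W ⊆ W') :
    xt p ends e s a W' ≤ xt p ends e s a W := by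
  unfold xt
  by_cases hW : e ∈ touches ends W
  · have hW' : e ∈ touches ends W' := touches_mono (ends := ends) h hW
    rw [if_pos hW, if_pos hW']
    exact prob_mono hp (Xdel_anti ends e s h a)
  · rw [if_neg hW]
    by_cases hW' : e ∈ touches ends W'
    · rw [if_pos hW']
      exact (prob_mono hp (Xdel_anti ends e s h a)).trans
        (prob_mono hp (Xdel_subset_XdelP ends e s W a))
    · rw [if_neg hW']
      exact prob_mono hp (XdelP_anti ends e s h a)

/-- **Theorem HALF-N** (mine-c): with `S = Σ_W [s ∉ W] P(K⁻ = W)`,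
`0 ≤ S · Σ x̃ ỹ λ − (Σ x₀ λ)(Σ ỹ λ) − (Σ y₀ λ)(Σ x̃ λ) + (Σ x₀ λ)(Σ y₀ λ)`. -/
theorem halfN (hp : IsProbVec p) (a b : V) :
    0 ≤ (∑ W : Set V, if s ∉ W then prob p (KEventM ends e T W) else 0) *
          (∑ W : Set V, if s ∉ W then xt p ends e s a W * xt p ends e s b W *
            prob p (KEventM ends e T W) else 0) -
        (∑ W : Set V, if s ∉ W then prob p (Xdel ends e s W a) * prob p (KEventM ends e T W) else 0) *
          (∑ W : Set V, if s ∉ W then xt p ends e s b W * prob p (KEventM ends e T W) else 0) -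
        (∑ W : Set V, if s ∉ W then prob p (Xdel ends e s W b) * prob p (KEventM ends e T W) else 0) *
          (∑ W : Set V, if s ∉ W then xt p ends e s a W * prob p (KEventM ends e T W) else 0) +
        (∑ W : Set V, if s ∉ W then prob p (Xdel ends e s W a) * prob p (KEventM ends e T W) else 0) *
          (∑ W : Set V, if s ∉ W then prob p (Xdel ends e s W b) * prob p (KEventM ends e T W) else 0) := by
  have hp₀ : IsProbVec (Function.update p e 0) := hp.update e le_rfl zero_le_one
  -- the seed-set BHK under `p[e ↦ 0]` with `1 − x̃`, `1 − ỹ`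
  have key := bhk_multi (Function.update p e 0) hp₀ ends T
    (F₁ := fun W => 1 - xt p ends e s a W) (F₂ := fun W => 1 - xt p ends e s b W)
    (fun W W' h => by simp only; linarith [xt_anti p ends e s hp a h])
    (fun W W' h => by simp only; linarith [xt_anti p ends e s hp b h])
    (fun W => sub_nonneg.2 (xt_le_one p ends e s hp a W))
    (fun W => sub_nonneg.2 (xt_le_one p ends e s hp b W)) {s} {s}
  rw [Finset.inter_self, Finset.union_self,
    expect_update_zero_K p ends e s T (fun W => 1 - xt p ends e s a W),
    expect_update_zero_K p ends e s T (fun W => 1 - xt p ends e s b W),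
    expect_update_zero_K p ends e s T
      ((fun W => 1 - xt p ends e s a W) * fun W => 1 - xt p ends e s b W)] at key
  simp only [Pi.mul_apply] at key
  -- the total mass of `λ₀`
  have hR : prob (Function.update p e 0) (avoidAllT ends T {s}) =
      ∑ W : Set V, if s ∉ W then prob p (KEventM ends e T W) else 0 := by
    have := expect_update_zero_K p ends e s T (fun _ => (1 : R))
    simp only [one_mul] at this
    rw [← this, prob_eq_expect_indicator]
  rw [hR] at key
  set S := ∑ W : Set V, if s ∉ W then prob p (KEventM ends e T W) else 0 with hS
  set Sxt := ∑ W : Set V, if s ∉ W then xt p ends e s a W * prob p (KEventM ends e T W) else 0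
  set Syt := ∑ W : Set V, if s ∉ W then xt p ends e s b W * prob p (KEventM ends e T W) else 0
  set Sxy := ∑ W : Set V, if s ∉ W then
    xt p ends e s a W * xt p ends e s b W * prob p (KEventM ends e T W) else 0
  set Sx0 := ∑ W : Set V, if s ∉ W then prob p (Xdel ends e s W a) * prob p (KEventM ends e T W) else 0
  set Sy0 := ∑ W : Set V, if s ∉ W then prob p (Xdel ends e s W b) * prob p (KEventM ends e T W) else 0
  have e1 : (∑ W : Set V, if s ∉ W then (1 - xt p ends e s a W) *
      prob p (KEventM ends e T W) else 0) = S - Sxt := by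
    rw [hS, ← Finset.sum_sub_distrib]
    refine Finset.sum_congr rfl fun W _ => ?_
    split_ifs <;> ring
  have e2 : (∑ W : Set V, if s ∉ W then (1 - xt p ends e s b W) *
      prob p (KEventM ends e T W) else 0) = S - Syt := by
    rw [hS, ← Finset.sum_sub_distrib]
    refine Finset.sum_congr rfl fun W _ => ?_
    split_ifs <;> ring
  have e3 : (∑ W : Set V, if s ∉ W then (1 - xt p ends e s a W) * (1 - xt p ends e s b W) *
      prob p (KEventM ends e T W) else 0) = S - Sxt - Syt + Sxy := by
    rw [hS, ← Finset.sum_sub_distrib, ← Finset.sum_sub_distrib, ← Finset.sum_add_distrib]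
    refine Finset.sum_congr rfl fun W _ => ?_
    split_ifs <;> ring
  rw [e1, e2, e3] at key
  have h1 : Sxt * Syt ≤ S * Sxy := by nlinarith [key]
  -- the shifts `x̃ ≥ x₀`, `ỹ ≥ y₀`
  have hx : Sx0 ≤ Sxt := by
    refine Finset.sum_le_sum fun W _ => ?_
    by_cases hs : s ∉ W
    · rw [if_pos hs, if_pos hs]
      exact mul_le_mul_of_nonneg_right (Xdel_le_xt p ends e s hp a W) (prob_nonneg hp _)
    · rw [if_neg hs, if_neg hs]
  have hy : Sy0 ≤ Syt := by
    refine Finset.sum_le_sum fun W _ => ?_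
    by_cases hs : s ∉ W
    · rw [if_pos hs, if_pos hs]
      exact mul_le_mul_of_nonneg_right (Xdel_le_xt p ends e s hp b W) (prob_nonneg hp _)
    · rw [if_neg hs, if_neg hs]
  have hprod := mul_nonneg (sub_nonneg.2 hx) (sub_nonneg.2 hy)
  nlinarith [h1, hprod]

end Main

end HalfN

end Summit.Ventures.PercRepro2
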